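import Literature.Geometry.Kaehler.ComplexTorusWeylOperatorPoincareSelfAdjoint
import Literature.Geometry.Kaehler.ComplexTorusLefschetzSL2Action
import Literature.Algebra.Lie.LefschetzModuleSL2RepresentationFunctoriality
import HarnessLib

/-!
# The cup-product adjoint of Beauville's `SL₂`-action: `⟨ρ(a b ; c d) x, y⟩ = ⟨x, ρ(d b ; c a) y⟩`, and the twisted isometry
# `Σ_m ⟨(ρ(γ) x)_m, (ρ(DγD) y)_{2g−m}⟩ = ⟨x, y⟩`, `D = diag(1, −1)`

Layer `Literature/Geometry/Kaehler`, namespace `Literature.Geometry.Kaehler.ComplexTorus`; lane `lit-hodgefound` (Track 2 foundations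
library), prover seat `lit-hodgefound-p09` (generation 52, row g52-#10). THEOREMS ONLY (no definition, no named fact, no instance, no
notation; D-0026 net debt `0`). Sequel of row g52-#3 `ComplexTorusWeylOperatorPoincareSelfAdjoint` (for the Poincaré / cup-product pairing
`⟨x, y⟩_e = poincarePairing Φ e h x y` on complementary degrees: `H` is skew, `L_η`, `Λ_η` and `w` are self-adjoint), of g51-#9
`ComplexTorusLefschetzSL2Action` (`ρ`) and of the abstract row `Algebra/Lie/LefschetzModuleSL2RepresentationFunctoriality` §InvariantForm
(`isAdjointPair_sl2Rep_of_coe_eq`: for a Poincaré-type pairing — `h` skew, `e` self-adjoint — the adjoint of `ρ(a b ; c d)` is `ρ(d b ; c a)`).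

SETTING. `X = E/Φ(ℤ^ι)`, `e : Fin N ≃ ι` a lattice frame (`N = 2g`), `⟨x, y⟩_e = poincarePairing Φ e h x y` for `x ∈ Hᵏ`, `y ∈ Hˡ`, `h : k + l = N`;
`ρ = (hasLefschetzProperty_lefschetzG hη).sl2Rep isZGrading_countingG : SL(2, ℂ) →* End_ℂ(GForm E ℂ)` (`η` non-degenerate). Since `ρ(γ) x` is in
general inhomogeneous, the statements are about its homogeneous components `(ρ(γ)(of k x))_m`.

THE ANTI-AUTOMORPHISM `ι(a b ; c d) = (d b ; c a)` of `SL₂` (`= D γ⁻¹ D`, `D = diag(1, −1)`) fixes both unipotent subgroups pointwise and the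
Weyl element, and reverses products; `exp(a L_η)`, `exp(a Λ_η)`, `w` are self-adjoint for `⟨ , ⟩_e` (André: "`L` […] auto-adjoint", "`ᶜΛ` […]
auto-adjoint"), so `ρ(γ)† = ρ(ι γ)` for every `γ`. Consequently `⟨ρ(γ) x, ρ(γ') y⟩ = ⟨x, y⟩` for `γ' = ι(γ)⁻¹ = D γ D`: `ρ` preserves the graded
cup pairing up to the outer twist `D` (for `γ = w`, `DwD = w⁻¹ = w³`, this is g52-#3's Parseval `⟨w x, w y⟩ = ±⟨x, y⟩`).

## What is proved

* §1 **`poincarePairing_sl2Rep_of_apply_comm`: `⟨(ρ(γ)(of k x))_m, y⟩_e = ⟨x, (ρ(ι γ)(of l y))_{k'}⟩_e`** (`m + l = N = k + k'`), with the instances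
  `poincarePairing_exp_smul_lefschetzG_comm` (`exp(a L_η)` self-adjoint), `poincarePairing_exp_smul_lefschetzDualG_comm` (`exp(a Λ_η)`),
  `poincarePairing_sl2Rep_diagonal_comm` (`⟨ρ(diag(t,t⁻¹)) x, y⟩ = ⟨x, ρ(diag(t⁻¹,t)) y⟩`).
* §2 **`sum_poincarePairing_sl2Rep_sl2Rep_conj_eq`: `Σ_{m ≤ N} ⟨(ρ(γ)(of k x))_m, (ρ(DγD)(of l y))_{N−m}⟩_e = ⟨x, y⟩_e`** (`k + l = N`) — the TWISTED
  ISOMETRY; `sum_poincarePairing_sl2Rep_sl2Rep_eq_zero` (the components pair to `0` in total when `k + l ≠ N`).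

## Sources, VERBATIM

* Y. André, *Pour une théorie inconditionnelle des motifs*, Publ. Math. IHÉS 83 (1996) [Andre1996Motifs], §1.1 (p. 11): "`L` […] auto-adjoint",
  "`ᶜΛ` […] auto-adjoint" (for `(x, y) ↦ ∫ x ∪ y`); Prop. 1.2 (p. 11).
* E. Looijenga, V. A. Lunts, *A Lie algebra attached to a projective variety*, Invent. Math. 129 (1997) [LooijengaLunts1997], §1 (1.3) p. 5:
  "So `𝔤(𝔞, M)` is then a subalgebra of `aut(M, φ)`".
* A. Beauville, *The action of SL₂ on abelian varieties* (2010) [Beauville2010SL2], §4 Theorem (the values of `ρ` on unipotents, torus, Weyl element).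
* H. Lange, *Abelian Varieties over the Complex Numbers* (2023) [Lange2023AbelianVarietiesComplex], §1.4.1 (p. 37, the cup-product pairing),
  §6.2.4 Prop. 6.2.20 (pp. 310–311, Parseval for `F`).
-/

noncomputable section

-- `Module ℂ` / `SMulZeroClass ℂ` synthesis on `E [⋀^Fin k]→L[ℝ] ℂ` (as in `ComplexTorusLefschetzDecomposition`)
set_option maxSynthPendingDepth 3

namespace Literature.Geometry.Kaehler

namespace ComplexTorus

open Module Function Finset
open scoped MatrixGroups
open Literature.LinearAlgebra.Alternating Literature.Algebra.Lie

universe uE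

variable {ι : Type*} [Fintype ι] [DecidableEq ι] {E : Type uE} [NormedAddCommGroup E] [NormedSpace ℂ E] [FiniteDimensional ℂ E]
  [Nontrivial E] (Φ : (ι → ℝ) ≃L[ℝ] E) {η : E [⋀^Fin 2]→L[ℝ] ℝ} {N : ℕ}

/-! ## §0 The graded cup-product pairing `B = Σ_{k+l=N} ⟨·_k, ·_l⟩_e` (private packaging, as in row g52-#3) -/

section Graded

omit [Fintype ι] [FiniteDimensional ℂ E] [Nontrivial E] in
/-- **The graded cup-product pairing** `B(w, w') = Σ_{k+l=N} ⟨w_k, w'_l⟩_e` on `H•(X; ℂ)`: a bilinear form restricting to `⟨ , ⟩_e` on complementary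
homogeneous components and to `0` on the others. [cite: Andre1996Motifs, §1.1 (p. 11, "(x, y) ↦ ∫ x ∪ y")] [cite: Lange2023AbelianVarietiesComplex, §1.4.1 (p. 37)] -/
private theorem exists_gradedPairing₇₀ (e : Fin N ≃ ι) :
    ∃ B : LinearMap.BilinForm ℂ (GForm E ℂ),
      (∀ (k l : ℕ) (h : k + l = N) (x : E [⋀^Fin k]→L[ℝ] ℂ) (y : E [⋀^Fin l]→L[ℝ] ℂ),
          B (GForm.of k x) (GForm.of l y) = poincarePairing Φ e h x y) ∧
      (∀ (k l : ℕ), k + l ≠ N → ∀ (x : E [⋀^Fin k]→L[ℝ] ℂ) (y : E [⋀^Fin l]→L[ℝ] ℂ), B (GForm.of k x) (GForm.of l y) = 0) := by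
  classical
  refine ⟨∑ k ∈ Finset.range (N + 1), ∑ l ∈ Finset.range (N + 1),
    if h : k + l = N then (poincarePairing Φ e h).compl₁₂ (LinearMap.proj (R := ℂ) (φ := fun m ↦ E [⋀^Fin m]→L[ℝ] ℂ) k)
      (LinearMap.proj (R := ℂ) (φ := fun m ↦ E [⋀^Fin m]→L[ℝ] ℂ) l) else 0, fun k l h x y ↦ ?_, fun k l hkl x y ↦ ?_⟩
  · simp only [LinearMap.sum_apply]
    rw [Finset.sum_eq_single_of_mem k (Finset.mem_range.2 (by omega)) fun k' _ hk' ↦ ?_]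
    · rw [Finset.sum_eq_single_of_mem l (Finset.mem_range.2 (by omega)) fun l' _ hl' ↦ ?_]
      · rw [dif_pos h, LinearMap.compl₁₂_apply, LinearMap.proj_apply, LinearMap.proj_apply, GForm.of_apply_self, GForm.of_apply_self]
      · split_ifs with h'
        · rw [LinearMap.compl₁₂_apply, LinearMap.proj_apply, LinearMap.proj_apply, GForm.of_apply_of_ne hl', map_zero]
        · rw [LinearMap.zero_apply, LinearMap.zero_apply]
    · refine Finset.sum_eq_zero fun l' _ ↦ ?_
      split_ifs with h'
      · rw [LinearMap.compl₁₂_apply, LinearMap.proj_apply, LinearMap.proj_apply, GForm.of_apply_of_ne hk', map_zero, LinearMap.zero_apply]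
      · rw [LinearMap.zero_apply, LinearMap.zero_apply]
  · simp only [LinearMap.sum_apply]
    refine Finset.sum_eq_zero fun k' _ ↦ Finset.sum_eq_zero fun l' _ ↦ ?_
    split_ifs with h'
    · rw [LinearMap.compl₁₂_apply, LinearMap.proj_apply, LinearMap.proj_apply]
      by_cases hk' : k' = k
      · subst hk'
        have hl' : l' ≠ l := fun hll ↦ hkl (hll ▸ h')
        rw [GForm.of_apply_of_ne hl', map_zero]
      · rw [GForm.of_apply_of_ne hk', map_zero, LinearMap.zero_apply]
    · rw [LinearMap.zero_apply, LinearMap.zero_apply]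

omit [Fintype ι] [DecidableEq ι] [Nontrivial E] in
/-- An adjoint pair is detected on homogeneous elements. [folklore] -/
private theorem isAdjointPair_of_forall_of₇₀ {B : LinearMap.BilinForm ℂ (GForm E ℂ)} {S T : Module.End ℂ (GForm E ℂ)}
    (hST : ∀ (a b : ℕ) (x : E [⋀^Fin a]→L[ℝ] ℂ) (y : E [⋀^Fin b]→L[ℝ] ℂ),
      B (S (GForm.of a x)) (GForm.of b y) = B (GForm.of a x) (T (GForm.of b y))) :
    LinearMap.IsAdjointPair B B S T := by
  intro w w'
  conv_lhs => rw [← sum_range_of_eq w, ← sum_range_of_eq w']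
  conv_rhs => rw [← sum_range_of_eq w, ← sum_range_of_eq w']
  simp only [map_sum, LinearMap.sum_apply, hST]

omit [Nontrivial E] in
/-- The graded pairing with `H` skew and `L_η` self-adjoint (rows g52-#3 `poincarePairing_countingG_skew`, `poincarePairing_lefschetzPow_one_comm`).
[cite: Andre1996Motifs, §1.1 (p. 11)] -/
private theorem exists_gradedPairing_skew_self₇₀ (η : E [⋀^Fin 2]→L[ℝ] ℝ) (e : Fin N ≃ ι) :
    ∃ B : LinearMap.BilinForm ℂ (GForm E ℂ),
      (∀ (k l : ℕ) (h : k + l = N) (x : E [⋀^Fin k]→L[ℝ] ℂ) (y : E [⋀^Fin l]→L[ℝ] ℂ),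
          B (GForm.of k x) (GForm.of l y) = poincarePairing Φ e h x y) ∧
      (∀ (k l : ℕ), k + l ≠ N → ∀ (x : E [⋀^Fin k]→L[ℝ] ℂ) (y : E [⋀^Fin l]→L[ℝ] ℂ), B (GForm.of k x) (GForm.of l y) = 0) ∧
      B.IsSkewAdjoint (countingG E) ∧ B.IsSelfAdjoint (lefschetzG η) := by
  obtain ⟨B, hB, hB0⟩ := exists_gradedPairing₇₀ Φ e
  refine ⟨B, hB, hB0, ?_, ?_⟩
  · change LinearMap.IsAdjointPair B B ⇑(countingG E) ⇑(-countingG E)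
    refine isAdjointPair_of_forall_of₇₀ fun a b x y ↦ ?_
    rw [countingG_of, LinearMap.neg_apply, countingG_of, map_neg, ← GForm.of_smul, ← GForm.of_smul]
    by_cases h : a + b = N
    · rw [hB a b h, hB a b h, poincarePairing_countingG_skew Φ e h]
    · rw [hB0 a b h, hB0 a b h, neg_zero]
  · refine isAdjointPair_of_forall_of₇₀ fun a b x y ↦ ?_
    rw [lefschetzG_of, lefschetzG_of]
    by_cases h : (a + 2) + b = N
    · rw [hB _ _ h, hB _ _ (show a + (b + 2) = N by omega), poincarePairing_lefschetzPow_one_comm Φ η e h (by omega)]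
    · rw [hB0 _ _ h, hB0 _ _ (show a + (b + 2) ≠ N by omega)]

omit [Nontrivial E] in
/-- **`B(w, of l y) = ⟨w_m, y⟩_e`** (`m + l = N`): only the complementary component of `w` pairs with a homogeneous `y`. [cite: Andre1996Motifs, §1.1 (p. 11)] -/
private theorem gradedPairing_apply_of₇₀ (e : Fin N ≃ ι) {B : LinearMap.BilinForm ℂ (GForm E ℂ)}
    (hB : ∀ (k l : ℕ) (h : k + l = N) (x : E [⋀^Fin k]→L[ℝ] ℂ) (y : E [⋀^Fin l]→L[ℝ] ℂ), B (GForm.of k x) (GForm.of l y) = poincarePairing Φ e h x y)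
    (hB0 : ∀ (k l : ℕ), k + l ≠ N → ∀ (x : E [⋀^Fin k]→L[ℝ] ℂ) (y : E [⋀^Fin l]→L[ℝ] ℂ), B (GForm.of k x) (GForm.of l y) = 0)
    (w : GForm E ℂ) {m l : ℕ} (h : m + l = N) (y : E [⋀^Fin l]→L[ℝ] ℂ) : B w (GForm.of l y) = poincarePairing Φ e h (w m) y := by
  have hN := finrank_complex_mul_two Φ e
  conv_lhs => rw [← sum_range_of_eq w]
  rw [map_sum, LinearMap.sum_apply, Finset.sum_eq_single_of_mem m (Finset.mem_range.2 (by omega)) fun a _ ha ↦ ?_]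
  · exact hB m l h (w m) y
  · exact hB0 a l (by omega) (w a) y

omit [Nontrivial E] in
/-- **`B(of k x, w) = ⟨x, w_{k'}⟩_e`** (`k + k' = N`). [cite: Andre1996Motifs, §1.1 (p. 11)] -/
private theorem gradedPairing_of_apply₇₀ (e : Fin N ≃ ι) {B : LinearMap.BilinForm ℂ (GForm E ℂ)}
    (hB : ∀ (k l : ℕ) (h : k + l = N) (x : E [⋀^Fin k]→L[ℝ] ℂ) (y : E [⋀^Fin l]→L[ℝ] ℂ), B (GForm.of k x) (GForm.of l y) = poincarePairing Φ e h x y)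
    (hB0 : ∀ (k l : ℕ), k + l ≠ N → ∀ (x : E [⋀^Fin k]→L[ℝ] ℂ) (y : E [⋀^Fin l]→L[ℝ] ℂ), B (GForm.of k x) (GForm.of l y) = 0)
    {k k' : ℕ} (h : k + k' = N) (x : E [⋀^Fin k]→L[ℝ] ℂ) (w : GForm E ℂ) : B (GForm.of k x) w = poincarePairing Φ e h x (w k') := by
  have hN := finrank_complex_mul_two Φ e
  conv_lhs => rw [← sum_range_of_eq w]
  rw [map_sum, Finset.sum_eq_single_of_mem k' (Finset.mem_range.2 (by omega)) fun a _ ha ↦ ?_]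
  · exact hB k k' h x (w k')
  · exact hB0 k a (by omega) x (w a)

omit [Nontrivial E] in
/-- **`B(w, w') = Σ_{m ≤ N} ⟨w_m, w'_{N−m}⟩_e`**. [cite: Andre1996Motifs, §1.1 (p. 11)] -/
private theorem gradedPairing_eq_sum₇₀ (e : Fin N ≃ ι) {B : LinearMap.BilinForm ℂ (GForm E ℂ)}
    (hB : ∀ (k l : ℕ) (h : k + l = N) (x : E [⋀^Fin k]→L[ℝ] ℂ) (y : E [⋀^Fin l]→L[ℝ] ℂ), B (GForm.of k x) (GForm.of l y) = poincarePairing Φ e h x y)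
    (hB0 : ∀ (k l : ℕ), k + l ≠ N → ∀ (x : E [⋀^Fin k]→L[ℝ] ℂ) (y : E [⋀^Fin l]→L[ℝ] ℂ), B (GForm.of k x) (GForm.of l y) = 0)
    (w w' : GForm E ℂ) : B w w' = ∑ m : Fin (N + 1), poincarePairing Φ e (show (m : ℕ) + (N - m) = N by omega) (w m) (w' (N - m)) := by
  have hN := finrank_complex_mul_two Φ e
  conv_lhs => rw [← sum_range_of_eq w]
  rw [map_sum, LinearMap.sum_apply, Finset.sum_range (fun a ↦ B (GForm.of a (w a)) w')]
  -- restrict the sum over `Fin (2g+1)` = `Fin (N+1)`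
  have hNg : 2 * finrank ℂ E = N := by omega
  subst hNg
  exact Finset.sum_congr rfl fun m _ ↦ gradedPairing_of_apply₇₀ Φ e hB hB0 (by omega) (w m) w'

end Graded

/-! ## §1 The adjoint of `ρ(a b ; c d)` is `ρ(d b ; c a)` -/

section Adjoint

/-- **`⟨(ρ(γ)(of k x))_m, y⟩_e = ⟨x, (ρ(ι γ)(of l y))_{k'}⟩_e`**, `ι(a b ; c d) = (d b ; c a)` (`m + l = N = k + k'`): the cup-product adjoint of
Beauville's `ρ(γ)` is `ρ` of the image of `γ` under the anti-automorphism fixing both unipotent subgroups (`H` is skew, `L_η`, `Λ_η` self-adjoint;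
abstract row `isAdjointPair_sl2Rep_of_coe_eq`). [cite: Andre1996Motifs, §1.1 (p. 11, "L […] auto-adjoint", "ᶜΛ […] auto-adjoint") and Prop. 1.2]
[cite: LooijengaLunts1997, §1 (1.3) p. 5] -/
theorem poincarePairing_sl2Rep_of_apply_comm (hη : ∀ v : E, v ≠ 0 → ∃ w : E, η ![v, w] ≠ 0) (e : Fin N ≃ ι) (γ γ' : SL(2, ℂ))
    (hγ' : (γ' : Matrix (Fin 2) (Fin 2) ℂ) = !![(γ : Matrix (Fin 2) (Fin 2) ℂ) 1 1, (γ : Matrix (Fin 2) (Fin 2) ℂ) 0 1;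
      (γ : Matrix (Fin 2) (Fin 2) ℂ) 1 0, (γ : Matrix (Fin 2) (Fin 2) ℂ) 0 0])
    {k l m k' : ℕ} (h₁ : m + l = N) (h₂ : k + k' = N) (x : E [⋀^Fin k]→L[ℝ] ℂ) (y : E [⋀^Fin l]→L[ℝ] ℂ) :
    poincarePairing Φ e h₁ ((hasLefschetzProperty_lefschetzG hη).sl2Rep isZGrading_countingG γ (GForm.of k x) m) y =
      poincarePairing Φ e h₂ x ((hasLefschetzProperty_lefschetzG hη).sl2Rep isZGrading_countingG γ' (GForm.of l y) k') := by
  obtain ⟨B, hB, hB0, hh, he⟩ := exists_gradedPairing_skew_self₇₀ Φ η e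
  have key := (hasLefschetzProperty_lefschetzG hη).isAdjointPair_sl2Rep_of_coe_eq isZGrading_countingG hh he γ γ' hγ' (GForm.of k x) (GForm.of l y)
  have h1 := gradedPairing_apply_of₇₀ Φ e hB hB0 ((hasLefschetzProperty_lefschetzG hη).sl2Rep isZGrading_countingG γ (GForm.of k x)) h₁ y
  have h2 := gradedPairing_of_apply₇₀ Φ e hB hB0 h₂ x ((hasLefschetzProperty_lefschetzG hη).sl2Rep isZGrading_countingG γ' (GForm.of l y))
  rw [← h1, ← h2]
  exact key

/-- **`exp(a L_η)` is self-adjoint: `⟨(exp(a L_η)(of k x))_m, y⟩_e = ⟨x, (exp(a L_η)(of l y))_{k'}⟩_e`** (`ι` fixes `(1 a ; 0 1)`).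
[cite: Andre1996Motifs, §1.1 (p. 11, "L […] auto-adjoint")] [cite: Beauville2010SL2, §4 Theorem ("(1 a ; 0 1)·z = e^{aθ} z")] -/
theorem poincarePairing_exp_smul_lefschetzG_comm (hη : ∀ v : E, v ≠ 0 → ∃ w : E, η ![v, w] ≠ 0) (e : Fin N ≃ ι) (a : ℂ)
    {k l m k' : ℕ} (h₁ : m + l = N) (h₂ : k + k' = N) (x : E [⋀^Fin k]→L[ℝ] ℂ) (y : E [⋀^Fin l]→L[ℝ] ℂ) :
    letI := Algebra.compHom (Module.End ℂ (GForm E ℂ)) (algebraMap ℚ ℂ)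
    poincarePairing Φ e h₁ (IsNilpotent.exp (a • lefschetzG η) (GForm.of k x) m) y =
      poincarePairing Φ e h₂ x (IsNilpotent.exp (a • lefschetzG η) (GForm.of l y) k') := by
  have hu : ((⟨!![(1 : ℂ), a; 0, 1], by rw [Matrix.det_fin_two_of]; ring⟩ : SL(2, ℂ)) : Matrix (Fin 2) (Fin 2) ℂ) = !![1, a; 0, 1] := rfl
  have key := poincarePairing_sl2Rep_of_apply_comm Φ hη e (⟨!![(1 : ℂ), a; 0, 1], by rw [Matrix.det_fin_two_of]; ring⟩ : SL(2, ℂ))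
    (⟨!![(1 : ℂ), a; 0, 1], by rw [Matrix.det_fin_two_of]; ring⟩ : SL(2, ℂ)) (by ext i j; fin_cases i <;> fin_cases j <;> simp) h₁ h₂ x y
  rw [(hasLefschetzProperty_lefschetzG hη).sl2Rep_apply_of_coe_eq_upper isZGrading_countingG _ hu] at key
  exact key

/-- **`exp(a Λ_η)` is self-adjoint: `⟨(exp(a Λ_η)(of k x))_m, y⟩_e = ⟨x, (exp(a Λ_η)(of l y))_{k'}⟩_e`** (`ι` fixes `(1 0 ; a 1)`).
[cite: Andre1996Motifs, §1.1 (p. 11, "ᶜΛ […] auto-adjoint")] [cite: Beauville2010SL2, §4 Theorem] -/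
theorem poincarePairing_exp_smul_lefschetzDualG_comm (hη : ∀ v : E, v ≠ 0 → ∃ w : E, η ![v, w] ≠ 0) (e : Fin N ≃ ι) (a : ℂ)
    {k l m k' : ℕ} (h₁ : m + l = N) (h₂ : k + k' = N) (x : E [⋀^Fin k]→L[ℝ] ℂ) (y : E [⋀^Fin l]→L[ℝ] ℂ) :
    letI := Algebra.compHom (Module.End ℂ (GForm E ℂ)) (algebraMap ℚ ℂ)
    poincarePairing Φ e h₁ (IsNilpotent.exp (a • lefschetzDualG η) (GForm.of k x) m) y =
      poincarePairing Φ e h₂ x (IsNilpotent.exp (a • lefschetzDualG η) (GForm.of l y) k') := by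
  have hl : ((⟨!![(1 : ℂ), 0; a, 1], by rw [Matrix.det_fin_two_of]; ring⟩ : SL(2, ℂ)) : Matrix (Fin 2) (Fin 2) ℂ) = !![1, 0; a, 1] := rfl
  have key := poincarePairing_sl2Rep_of_apply_comm Φ hη e (⟨!![(1 : ℂ), 0; a, 1], by rw [Matrix.det_fin_two_of]; ring⟩ : SL(2, ℂ))
    (⟨!![(1 : ℂ), 0; a, 1], by rw [Matrix.det_fin_two_of]; ring⟩ : SL(2, ℂ)) (by ext i j; fin_cases i <;> fin_cases j <;> simp) h₁ h₂ x y
  rw [sl2Rep_lower hη _ hl] at key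
  exact key

/-- **`⟨(ρ(diag(t, t⁻¹)) (of k x))_m, y⟩_e = ⟨x, (ρ(diag(t⁻¹, t)) (of l y))_{k'}⟩_e`** (`ι` swaps the diagonal entries; `H` is skew: `(tʰ)† = t^{−h}`).
[cite: Andre1996Motifs, §1.1 (p. 11)] [cite: Beauville2010SL2, §4 Theorem ("(n 0 ; 0 n⁻¹)·z = n^{−g} n^*z")] -/
theorem poincarePairing_sl2Rep_diagonal_comm (hη : ∀ v : E, v ≠ 0 → ∃ w : E, η ![v, w] ≠ 0) (e : Fin N ≃ ι) (γ γ' : SL(2, ℂ)) {t : ℂ}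
    (hγ : (γ : Matrix (Fin 2) (Fin 2) ℂ) = !![t, 0; 0, t⁻¹]) (hγ' : (γ' : Matrix (Fin 2) (Fin 2) ℂ) = !![t⁻¹, 0; 0, t])
    {k l m k' : ℕ} (h₁ : m + l = N) (h₂ : k + k' = N) (x : E [⋀^Fin k]→L[ℝ] ℂ) (y : E [⋀^Fin l]→L[ℝ] ℂ) :
    poincarePairing Φ e h₁ ((hasLefschetzProperty_lefschetzG hη).sl2Rep isZGrading_countingG γ (GForm.of k x) m) y =
      poincarePairing Φ e h₂ x ((hasLefschetzProperty_lefschetzG hη).sl2Rep isZGrading_countingG γ' (GForm.of l y) k') :=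
  poincarePairing_sl2Rep_of_apply_comm Φ hη e γ γ' (by rw [hγ', hγ]; ext i j; fin_cases i <;> fin_cases j <;> simp) h₁ h₂ x y

end Adjoint

/-! ## §2 The twisted isometry: `Σ_m ⟨(ρ(γ) x)_m, (ρ(DγD) y)_{N−m}⟩ = ⟨x, y⟩` -/

section Isometry

omit [Fintype ι] [DecidableEq ι] [NormedAddCommGroup E] [NormedSpace ℂ E] [FiniteDimensional ℂ E] [Nontrivial E] in
/-- `det (a −b ; −c d) = 1` for `(a b ; c d) ∈ SL₂`. [folklore] -/
private theorem det_conjD_eq_one₇₀ (γ : SL(2, ℂ)) :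
    Matrix.det !![(γ : Matrix (Fin 2) (Fin 2) ℂ) 0 0, -(γ : Matrix (Fin 2) (Fin 2) ℂ) 0 1;
      -(γ : Matrix (Fin 2) (Fin 2) ℂ) 1 0, (γ : Matrix (Fin 2) (Fin 2) ℂ) 1 1] = 1 := by
  have h1 := γ.prop
  rw [Matrix.det_fin_two] at h1
  rw [Matrix.det_fin_two_of]
  linear_combination h1

omit [Fintype ι] [DecidableEq ι] [NormedAddCommGroup E] [NormedSpace ℂ E] [FiniteDimensional ℂ E] [Nontrivial E] in
/-- `det (d b ; c a) = 1` for `(a b ; c d) ∈ SL₂`. [folklore] -/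
private theorem det_swap_eq_one₇₀ (γ : SL(2, ℂ)) :
    Matrix.det !![(γ : Matrix (Fin 2) (Fin 2) ℂ) 1 1, (γ : Matrix (Fin 2) (Fin 2) ℂ) 0 1;
      (γ : Matrix (Fin 2) (Fin 2) ℂ) 1 0, (γ : Matrix (Fin 2) (Fin 2) ℂ) 0 0] = 1 := by
  have h1 := γ.prop
  rw [Matrix.det_fin_two] at h1
  rw [Matrix.det_fin_two_of]
  linear_combination h1

omit [Fintype ι] [DecidableEq ι] [NormedAddCommGroup E] [NormedSpace ℂ E] [FiniteDimensional ℂ E] [Nontrivial E] in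
/-- **`ι(γ) · (D γ D) = 1`**: `(d b ; c a)(a −b ; −c d) = (ad − bc) · 1`. [folklore] -/
private theorem swap_mul_conjD_eq_one₇₀ (γ : SL(2, ℂ)) :
    (show SL(2, ℂ) from ⟨_, det_swap_eq_one₇₀ γ⟩) * (show SL(2, ℂ) from ⟨_, det_conjD_eq_one₇₀ γ⟩) = 1 := by
  have h1 := γ.prop
  rw [Matrix.det_fin_two] at h1
  refine Subtype.ext ?_
  rw [Matrix.SpecialLinearGroup.coe_mul, Matrix.SpecialLinearGroup.coe_one]
  ext a b; fin_cases a <;> fin_cases b <;> simp [Matrix.mul_apply, Fin.sum_univ_two]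
  all_goals first | linear_combination h1 | ring1

/-- **THE TWISTED ISOMETRY: `Σ_{m ≤ N} ⟨(ρ(γ)(of k x))_m, (ρ(γᴰ)(of l y))_{N−m}⟩_e = ⟨x, y⟩_e`** for `x ∈ Hᵏ`, `y ∈ Hˡ`, `k + l = N`, where
`γᴰ = D γ D = (a −b ; −c d)` for `γ = (a b ; c d)`, `D = diag(1, −1)` — `ρ(γ)† = ρ(ι γ)` and `ι(γ) γᴰ = 1`. For `γ = w = (0 −1 ; 1 0)`, `γᴰ = w⁻¹`,
this is the Parseval identity of row g52-#3. [cite: Andre1996Motifs, §1.1–§1.2 (p. 11)] [cite: LooijengaLunts1997, §1 (1.3) p. 5]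
[cite: Lange2023AbelianVarietiesComplex, §6.2.4 Prop. 6.2.20 (pp. 310–311, Parseval)] -/
theorem sum_poincarePairing_sl2Rep_sl2Rep_conj_eq (hη : ∀ v : E, v ≠ 0 → ∃ w : E, η ![v, w] ≠ 0) (e : Fin N ≃ ι) (γ γD : SL(2, ℂ))
    (hγD : (γD : Matrix (Fin 2) (Fin 2) ℂ) = !![(γ : Matrix (Fin 2) (Fin 2) ℂ) 0 0, -(γ : Matrix (Fin 2) (Fin 2) ℂ) 0 1;
      -(γ : Matrix (Fin 2) (Fin 2) ℂ) 1 0, (γ : Matrix (Fin 2) (Fin 2) ℂ) 1 1])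
    {k l : ℕ} (h : k + l = N) (x : E [⋀^Fin k]→L[ℝ] ℂ) (y : E [⋀^Fin l]→L[ℝ] ℂ) :
    ∑ m : Fin (N + 1), poincarePairing Φ e (show (m : ℕ) + (N - m) = N by omega)
        ((hasLefschetzProperty_lefschetzG hη).sl2Rep isZGrading_countingG γ (GForm.of k x) m)
        ((hasLefschetzProperty_lefschetzG hη).sl2Rep isZGrading_countingG γD (GForm.of l y) (N - m)) =
      poincarePairing Φ e h x y := by
  obtain ⟨B, hB, hB0, hh, he⟩ := exists_gradedPairing_skew_self₇₀ Φ η e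
  have hγD' : γD = (show SL(2, ℂ) from ⟨_, det_conjD_eq_one₇₀ γ⟩) := Subtype.ext hγD
  have key := (hasLefschetzProperty_lefschetzG hη).isAdjointPair_sl2Rep_of_coe_eq isZGrading_countingG hh he γ
    (show SL(2, ℂ) from ⟨_, det_swap_eq_one₇₀ γ⟩) rfl
    (GForm.of k x) ((hasLefschetzProperty_lefschetzG hη).sl2Rep isZGrading_countingG γD (GForm.of l y))
  rw [← Module.End.mul_apply, ← map_mul, hγD', swap_mul_conjD_eq_one₇₀, map_one, Module.End.one_apply, hB k l h,
    gradedPairing_eq_sum₇₀ Φ e hB hB0] at key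
  rw [hγD']
  exact key

/-- When `k + l ≠ N` the components pair to `0` in total: `Σ_m ⟨(ρ(γ) x)_m, (ρ(γᴰ) y)_{N−m}⟩_e = 0`. [cite: Andre1996Motifs, §1.1 (p. 11)] -/
theorem sum_poincarePairing_sl2Rep_sl2Rep_conj_eq_zero (hη : ∀ v : E, v ≠ 0 → ∃ w : E, η ![v, w] ≠ 0) (e : Fin N ≃ ι) (γ γD : SL(2, ℂ))
    (hγD : (γD : Matrix (Fin 2) (Fin 2) ℂ) = !![(γ : Matrix (Fin 2) (Fin 2) ℂ) 0 0, -(γ : Matrix (Fin 2) (Fin 2) ℂ) 0 1;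
      -(γ : Matrix (Fin 2) (Fin 2) ℂ) 1 0, (γ : Matrix (Fin 2) (Fin 2) ℂ) 1 1])
    {k l : ℕ} (h : k + l ≠ N) (x : E [⋀^Fin k]→L[ℝ] ℂ) (y : E [⋀^Fin l]→L[ℝ] ℂ) :
    ∑ m : Fin (N + 1), poincarePairing Φ e (show (m : ℕ) + (N - m) = N by omega)
        ((hasLefschetzProperty_lefschetzG hη).sl2Rep isZGrading_countingG γ (GForm.of k x) m)
        ((hasLefschetzProperty_lefschetzG hη).sl2Rep isZGrading_countingG γD (GForm.of l y) (N - m)) = 0 := by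
  obtain ⟨B, hB, hB0, hh, he⟩ := exists_gradedPairing_skew_self₇₀ Φ η e
  have hγD' : γD = (show SL(2, ℂ) from ⟨_, det_conjD_eq_one₇₀ γ⟩) := Subtype.ext hγD
  have key := (hasLefschetzProperty_lefschetzG hη).isAdjointPair_sl2Rep_of_coe_eq isZGrading_countingG hh he γ
    (show SL(2, ℂ) from ⟨_, det_swap_eq_one₇₀ γ⟩) rfl
    (GForm.of k x) ((hasLefschetzProperty_lefschetzG hη).sl2Rep isZGrading_countingG γD (GForm.of l y))
  rw [← Module.End.mul_apply, ← map_mul, hγD', swap_mul_conjD_eq_one₇₀, map_one, Module.End.one_apply, hB0 k l h,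
    gradedPairing_eq_sum₇₀ Φ e hB hB0] at key
  rw [hγD']
  exact key

end Isometry

end ComplexTorus

end Literature.Geometry.Kaehler

end
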